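/-
Copyright: cell pub-balaban-gaps (YM BLITZ Y1, track G1), seat g1-p2 GEN 5 (unit `pub-balaban-gaps-g1-p2`).  Row (D4) NODE O,
OBJECT ∕ MECHANISM level: the LOCAL-INVERSE LETTERS of the parametrix junction (`D4WalkBlockParametrix`: `hPL`, `hinv`, `hLan`,
`hLbd`, reality) SUPPLIED from ACCRETIVITY — `G′_□(u) := extend((compress (1 + K′(u)) □̃)⁻¹)` (the prior programme's
`Beta/UnitLatticeLocalInverse`, unit `b2b-balaban-beta-d4-p3` 2026-08-20, BY NAME) is a local inverse, entrywise holomorphic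
in `u`, with block bound `c_s∕m` from UNIFORM CONJUGATED COERCIVITY `m` of `1 + K′(u)` on the ball (Combes–Thomas,
`Beta/AccretiveCombesThomas.norm_inv_apply_le`) and a site row sum `c_s`; the uniform coercivity itself from coercivity at the
REAL point + a Schur budget of the complex remainder (§1–§2 = g1-plan-1 GEN 14's skeleton #13 `skel13_J2a_u_half`, d551fa154d022594,
declarations byte-identical, FILED here on the planner's reading-copy offer, provenance theirs).  END: Thm 3.10 at one scale in
block currency whose operator letters are about `Δ′(u) = 1 + K′(u)` ITSELF (holomorphy, range, block bound, coercivity) — no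
inverse in the hypotheses.
HONEST FRAMING: mechanism; Bałaban's `Δ^{(k)}(𝐔)` and its k-UNIFORM coercivity on the small-field analyticity domain ([B9]
Thms 3.1–3.3) are NOT constructed ∕ proved — THE letter `h0`∕`hr`∕`hcc` below; (D4) NOT discharged (0∕1); NOT continuum, NOT Clay.
-/
import Summits.QuantumFields.BalabanUV.Gaps.D4WalkBlockCommutator
import Summits.QuantumFields.BalabanUV.Beta.UnitLatticeLocalInverse
import Literature.MathematicalPhysics.QuantumFieldTheory.Balaban1983to89.B13CovarianceDifference216

/-!
# `Gaps.D4WalkBlockLocalInverse` — the local inverses `G′_□(u)` from accretivity: holomorphic, block-bounded, real at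
`u = 0`; Thm 3.10 at one scale with letters on `Δ′(u)` only (cell pub-balaban-gaps, seat g1-p2 gen 5)

HONEST DEPENDENCY (cell pub-balaban, verbatim): continuum YM on T⁴ ⇐ BetaPertH ∧ nine spine estimates (0/9 proved);
BetaPertH ⇐ (D1) ∧ (D4) ∧ CAP+tail.

[B9] p. 409: *"This theorem follows simply from Corollary 3.6 holding for all G′_□"*; Cor 3.6 ∕ Thms 3.1–3.3 (3.42): the local
inverses exist with exponentially decaying kernels because `Δ′` is bounded below (positivity of the averaging term) — on the
complex small-field domain ([II] p. 15: *"analytic functions on the space of configurations (U, J)"*).  ABSTRACTLY: a family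
`u ↦ A(u) = 1 + K′(u)` of finite matrices, entrywise holomorphic on a ball, CONJUGATED-COERCIVE (`m·‖z‖² ≤ Re Σ z̄_e
e^{κ(ρ_e−ρ_{e′})}A(e,e′)z_{e′}` along every column weight `ρ = d(·,j)`) uniformly on the ball.
* §1–§2 (skeleton #13, g1-plan-1 GEN 14): conjugated Schur test `norm_conjForm_le_schur`; STABILITY
  `conjCoercive_uniform_of_schur` — base coercivity `m` of `A₀` + Schur sums `≤ c_r, c_c` of `A(u) − A₀` ⟹ coercivity
  `m − ½(c_r + c_c)` uniformly (the located J-2a-u★ input: ONE Schur budget of the complexified remainder).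
* §3 THE LOCAL INVERSE `extend((compress A(u) S)⁻¹)` (prior engine BY NAME): unit (`isUnit_compress`), the two algebraic
  letters `hPL` ∕ `hinv` (`Pj_mul_extend`, `Pj_mul_mul_Pj_mul_extend_inv`), entrywise Combes–Thomas bound
  `norm_locInv_apply_le` (`≤ m⁻¹e^{−κd(i,j)}`), **block letter** `blockNorm_locInv_le` (`≤ c_s∕m` with the site row sum
  `Σ_j e^{−κd(i,j)} ≤ c_s` — print's (3.42) summed over a cube = O(1), NO fibre), holomorphy `differentiableOn_locInv`, reality
  `im_locInv_zero`.
* §4 END `blockWalkExpansion_accretive`: `D4WalkBlockCommutator.blockWalkExpansion_parametrix_lipschitz` with the local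
  inverses CONSTRUCTED and their letters DISCHARGED: Thm 3.10 at one scale in block currency from — `K′` entrywise holomorphic,
  range `r₁`, block bound `C_K`; `1 + K′(u)` conjugated-coercive `m` at rate `κ` uniformly on the ball; site row sum `c_s`;
  partition (`|h| ≤ 1`, `1∕M`-Lipschitz, `Σ h² = 1` not even needed here, supports + `r₁`-neighbourhoods inside the domains);
  geometry; cube row sum; margin with `C_L = c_s∕m`, `λ_K = (r₁∕M)C_K`.
WHAT IT IS NOT: the k-UNIFORM coercivity of Bałaban's `Δ^{(k)}(𝐔)` on the analyticity domain ([B9] Thms 3.1–3.3, the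
averaging-term positivity) is THE remaining operator letter at one scale; multi-scale, (v), `TermDomination` remain; (D4)
instance 0∕1; words UNCHANGED.
-/

noncomputable section

namespace Summit.QuantumFields.BalabanUV.Gaps.D4WalkBlockLocalInverse

open Metric Set Finset Complex Matrix
open scoped BigOperators Matrix ComplexConjugate
open Literature.MathematicalPhysics.QuantumFieldTheory.Balaban1983to89
open Literature.MathematicalPhysics.QuantumFieldTheory.Balaban1983to89.B9SectDWalk (Through MajSumLe DomBy)
open Literature.MathematicalPhysics.QuantumFieldTheory.Balaban1983to89.B9Thm34Ext (toB6)
open Literature.MathematicalPhysics.QuantumFieldTheory.Balaban1983to89.B9Thm37GlueTorus (torusGeom tdist1 tdist1_nonneg)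
open Literature.MathematicalPhysics.QuantumFieldTheory.Balaban1983to89.TreeLengthTorus (TPt)
open Literature.MathematicalPhysics.QuantumFieldTheory.Balaban1983to89.B5TorusCover (UT)
open Literature.MathematicalPhysics.QuantumFieldTheory.Balaban1983to89.B11SectG (RowSum)
open Literature.MathematicalPhysics.QuantumFieldTheory.Balaban1983to89.B5Prop11Lower (nsq nsq_nonneg)
open Literature.MathematicalPhysics.QuantumFieldTheory.Balaban1983to89.B13DomainKernelWalks (DomainTerms)
open Literature.MathematicalPhysics.QuantumFieldTheory.Balaban1983to89.B13CovarianceDifference216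
  (differentiableOn_matrix_inv)
open Summit.QuantumFields.BalabanUV.Gaps.D4WalkBlock
  (rowMass blockNorm blockNorm_nonneg rowMass_le_blockNorm blockNorm_le_of_rowMass_le BlockWalkExpansion)
open Summit.QuantumFields.BalabanUV.Gaps.D4WalkBlockCommutator (blockWalkExpansion_parametrix_lipschitz)
open Summit.QuantumFields.BalabanUV.T4Continuum.Spine.NE5.TwoRunPencilDomains (withOp)
open Summit.QuantumFields.BalabanUV.Beta.UnitLatticeWalkInversion (Hd Pj)
open Summit.QuantumFields.BalabanUV.Beta.UnitLatticeLocalInverse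
  (compress extend extend_apply_of_mem extend_apply_of_not_mem_left extend_apply_of_not_mem_right Pj_mul_extend
    Pj_mul_mul_Pj_mul_extend_inv conjCoercive_compress)
open Summit.QuantumFields.BalabanUV.Beta.AccretiveCombesThomas (conjForm conjForm_add isUnit_of_conjCoercive
  norm_inv_apply_le)

variable {ι : Type*} [Fintype ι]

/-! ## §1. The conjugated Schur bound of an arbitrary complex kernel (skeleton #13 §1, g1-plan-1 GEN 14) -/

/-- Conjugated ROW sum `Σ_{e′} ‖R(e,e′)‖ e^{κ(ρ_e − ρ_{e′})}`. [folklore] -/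
def cRow (R : Matrix ι ι ℂ) (κ : ℝ) (ρ : ι → ℝ) (e : ι) : ℝ := ∑ e', ‖R e e'‖ * Real.exp (κ * (ρ e - ρ e'))

/-- Conjugated COLUMN sum `Σ_{e} ‖R(e,e′)‖ e^{κ(ρ_e − ρ_{e′})}`. [folklore] -/
def cCol (R : Matrix ι ι ℂ) (κ : ℝ) (ρ : ι → ℝ) (e' : ι) : ℝ := ∑ e, ‖R e e'‖ * Real.exp (κ * (ρ e - ρ e'))

/-- The conjugated form is bounded by the weighted absolute double sum. [folklore] -/
theorem norm_conjForm_le_sum (R : Matrix ι ι ℂ) (κ : ℝ) (ρ : ι → ℝ) (z : ι → ℂ) :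
    ‖conjForm R κ ρ z‖ ≤ ∑ e, ∑ e', ‖z e‖ * ‖R e e'‖ * ‖z e'‖ * Real.exp (κ * (ρ e - ρ e')) := by
  unfold conjForm
  refine (norm_sum_le _ _).trans (Finset.sum_le_sum fun e _ => ?_)
  refine (norm_sum_le _ _).trans (Finset.sum_le_sum fun e' _ => ?_)
  rw [norm_mul, norm_mul, norm_mul, Complex.norm_conj, Complex.norm_real, Real.norm_eq_abs,
    abs_of_pos (Real.exp_pos _)]
  ring_nf
  rfl

/-- **Conjugated Schur test**: `‖conjForm R κ ρ z‖ ≤ ½(S_row + S_col)·‖z‖²`. [folklore] -/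
theorem norm_conjForm_le_schur (R : Matrix ι ι ℂ) (κ : ℝ) (ρ : ι → ℝ) {Sr Sc : ℝ}
    (hr : ∀ e, cRow R κ ρ e ≤ Sr) (hc : ∀ e', cCol R κ ρ e' ≤ Sc) (z : ι → ℂ) :
    ‖conjForm R κ ρ z‖ ≤ (Sr + Sc) / 2 * nsq z := by
  have hD := norm_conjForm_le_sum R κ ρ z
  have hamgm : ∑ e, ∑ e', ‖z e‖ * ‖R e e'‖ * ‖z e'‖ * Real.exp (κ * (ρ e - ρ e'))
      ≤ (∑ e, ‖z e‖ ^ 2 / 2 * cRow R κ ρ e) + ∑ e', ‖z e'‖ ^ 2 / 2 * cCol R κ ρ e' := by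
    have h1 : ∑ e, ∑ e', ‖z e‖ * ‖R e e'‖ * ‖z e'‖ * Real.exp (κ * (ρ e - ρ e'))
        ≤ ∑ e, ∑ e', (‖z e‖ ^ 2 / 2 * (‖R e e'‖ * Real.exp (κ * (ρ e - ρ e')))
            + ‖z e'‖ ^ 2 / 2 * (‖R e e'‖ * Real.exp (κ * (ρ e - ρ e')))) := by
      refine Finset.sum_le_sum fun e _ => Finset.sum_le_sum fun e' _ => ?_
      have hw : 0 ≤ ‖R e e'‖ * Real.exp (κ * (ρ e - ρ e')) := mul_nonneg (norm_nonneg _) (Real.exp_nonneg _)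
      have : ‖z e‖ * ‖z e'‖ ≤ ‖z e‖ ^ 2 / 2 + ‖z e'‖ ^ 2 / 2 := by nlinarith [sq_nonneg (‖z e‖ - ‖z e'‖)]
      calc ‖z e‖ * ‖R e e'‖ * ‖z e'‖ * Real.exp (κ * (ρ e - ρ e'))
          = (‖z e‖ * ‖z e'‖) * (‖R e e'‖ * Real.exp (κ * (ρ e - ρ e'))) := by ring
        _ ≤ (‖z e‖ ^ 2 / 2 + ‖z e'‖ ^ 2 / 2) * (‖R e e'‖ * Real.exp (κ * (ρ e - ρ e'))) :=
          mul_le_mul_of_nonneg_right this hw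
        _ = _ := by ring
    refine h1.trans (le_of_eq ?_)
    rw [Finset.sum_congr rfl fun e _ => Finset.sum_add_distrib, Finset.sum_add_distrib]
    congr 1
    · refine Finset.sum_congr rfl fun e _ => ?_
      rw [cRow, Finset.mul_sum]
    · rw [Finset.sum_comm]
      refine Finset.sum_congr rfl fun e' _ => ?_
      rw [cCol, Finset.mul_sum]
  have hrow : ∑ e, ‖z e‖ ^ 2 / 2 * cRow R κ ρ e ≤ Sr / 2 * nsq z := by
    rw [nsq, Finset.mul_sum]
    refine Finset.sum_le_sum fun e _ => ?_
    have := hr e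
    have h0 : 0 ≤ cRow R κ ρ e := Finset.sum_nonneg fun e' _ => mul_nonneg (norm_nonneg _) (Real.exp_nonneg _)
    nlinarith [sq_nonneg ‖z e‖]
  have hcol : ∑ e', ‖z e'‖ ^ 2 / 2 * cCol R κ ρ e' ≤ Sc / 2 * nsq z := by
    rw [nsq, Finset.mul_sum]
    refine Finset.sum_le_sum fun e' _ => ?_
    have := hc e'
    have h0 : 0 ≤ cCol R κ ρ e' := Finset.sum_nonneg fun e _ => mul_nonneg (norm_nonneg _) (Real.exp_nonneg _)
    nlinarith [sq_nonneg ‖z e'‖]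
  linarith

/-- The real part of the conjugated form of a Schur-budgeted remainder is `≥ −½(S_row + S_col)·‖z‖²`. [folklore] -/
theorem re_conjForm_ge_neg_schur (R : Matrix ι ι ℂ) (κ : ℝ) (ρ : ι → ℝ) {Sr Sc : ℝ}
    (hr : ∀ e, cRow R κ ρ e ≤ Sr) (hc : ∀ e', cCol R κ ρ e' ≤ Sc) (z : ι → ℂ) :
    -((Sr + Sc) / 2 * nsq z) ≤ (conjForm R κ ρ z).re := by
  have h := norm_conjForm_le_schur R κ ρ hr hc z
  have h' := Complex.abs_re_le_norm (conjForm R κ ρ z)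
  linarith [neg_abs_le (conjForm R κ ρ z).re]

/-! ## §2. Stability of UNIFORM conjugated coercivity under a Schur-budgeted complex remainder (skeleton #13 §2) -/

/-- **Stability**: base coercivity `m` of `A₀` along every column weight `d(·,j)` plus conjugated Schur sums `≤ c_r`, `≤ c_c` of
the remainders `A(u) − A₀`, `u ∈ S`, give conjugated coercivity `m − ½(c_r + c_c)` of `A(u)` uniformly on `S` (the located
J-2a-u★ shape: for Bałaban, `A₀ = Δ^{(k)}` at the real configuration, the remainder its complexification defect). [folklore] -/
theorem conjCoercive_uniform_of_schur {E : Type*} {A : E → Matrix ι ι ℂ} {S : Set E} (A₀ : Matrix ι ι ℂ)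
    (d : ι → ι → ℝ) {κ m cr cc : ℝ}
    (h0 : ∀ j, ∀ z : ι → ℂ, m * nsq z ≤ (conjForm A₀ κ (fun e => d e j) z).re)
    (hr : ∀ u ∈ S, ∀ j e, cRow (A u - A₀) κ (fun e => d e j) e ≤ cr)
    (hcc : ∀ u ∈ S, ∀ j e', cCol (A u - A₀) κ (fun e => d e j) e' ≤ cc) :
    ∀ u ∈ S, ∀ j, ∀ z : ι → ℂ, (m - (cr + cc) / 2) * nsq z ≤ (conjForm (A u) κ (fun e => d e j) z).re := by
  intro u hu j z
  have hsplit : A u = A₀ + (A u - A₀) := by rw [add_sub_cancel]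
  have hP := re_conjForm_ge_neg_schur (A u - A₀) κ (fun e => d e j) (hr u hu j) (hcc u hu j) z
  rw [hsplit, conjForm_add, Complex.add_re]
  have := h0 j z
  nlinarith [nsq_nonneg z]

/-! ## §3. The local inverse `extend((compress A S)⁻¹)`: unit, algebraic letters, Combes–Thomas, block letter, holomorphy, reality -/

section LocInv

variable {n : Type} [Fintype n] [DecidableEq n]

/-- **The compression of a conjugated-coercive matrix is a unit** (coercivity passes to the compression,
`conjCoercive_compress`; empty compressions are units trivially). [folklore] -/
theorem isUnit_compress (A : Matrix n n ℂ) (S : Finset n) (d : n → n → ℝ) {κ m : ℝ} (hm : 0 < m)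
    (hc : ∀ j, ∀ z : n → ℂ, m * nsq z ≤ (conjForm A κ (fun e => d e j) z).re) : IsUnit (compress A S) := by
  rcases isEmpty_or_nonempty S with hS | ⟨⟨j, hj⟩⟩
  · exact ⟨⟨compress A S, compress A S, Subsingleton.elim _ _, Subsingleton.elim _ _⟩, rfl⟩
  · exact isUnit_of_conjCoercive (ρ := fun k : S => d k j) hm
      (fun z => conjCoercive_compress A κ (fun e => d e j) (hc j) z)

/-- **Entrywise Combes–Thomas bound of the extended local inverse**: `‖extend((compress A S)⁻¹)(i,j)‖ ≤ m⁻¹e^{−κd(i,j)}`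
(`norm_inv_apply_le` on the subtype; rows ∕ columns outside `S` vanish). [cite: Balaban1985BackgroundPropagators, (3.42) p.399, Cor 3.6 p.408] -/
theorem norm_locInv_apply_le (A : Matrix n n ℂ) (S : Finset n) (d : n → n → ℝ) (hd0 : ∀ j, d j j = 0) {κ m : ℝ}
    (hκ : 0 ≤ κ) (hm : 0 < m) (hc : ∀ j, ∀ z : n → ℂ, m * nsq z ≤ (conjForm A κ (fun e => d e j) z).re) (i j : n) :
    ‖extend (compress A S)⁻¹ i j‖ ≤ m⁻¹ * Real.exp (-(κ * d i j)) := by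
  by_cases hi : i ∈ S
  · by_cases hj : j ∈ S
    · rw [extend_apply_of_mem _ hi hj]
      have h := norm_inv_apply_le (compress A S) (fun k l : S => d k l) (fun l => hd0 l) hκ hm
        (fun j' z => conjCoercive_compress A κ (fun e => d e j') (hc j') z) ⟨i, hi⟩ ⟨j, hj⟩
      calc ‖(compress A S)⁻¹ ⟨i, hi⟩ ⟨j, hj⟩‖ ≤ Real.exp (-(κ * d i j)) / m := h
        _ = m⁻¹ * Real.exp (-(κ * d i j)) := by rw [div_eq_inv_mul]
    · rw [extend_apply_of_not_mem_right _ i hj, norm_zero]; positivity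
  · rw [extend_apply_of_not_mem_left _ hi j, norm_zero]; positivity

/-- **BLOCK LETTER of the local inverse** — print's (3.42) summed over a cube is O(1), NO fibre: with the site row sum
`Σ_j e^{−κd(i,j)} ≤ c_s`, `‖extend((compress A S)⁻¹)‖_{y,y′} ≤ c_s∕m`. [cite: Balaban1985BackgroundPropagators, (3.42) p.399, Cor 3.6 p.408, (3.89) p.409] -/
theorem blockNorm_locInv_le {ν : ℕ} {K : Fin ν → ℕ} (cubn : n → UT K) (A : Matrix n n ℂ) (S : Finset n)
    (d : n → n → ℝ) (hd0 : ∀ j, d j j = 0) {κ m cs : ℝ} (hκ : 0 ≤ κ) (hm : 0 < m)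
    (hc : ∀ j, ∀ z : n → ℂ, m * nsq z ≤ (conjForm A κ (fun e => d e j) z).re)
    (hcs : 0 ≤ cs) (hsite : ∀ i, ∑ j, Real.exp (-(κ * d i j)) ≤ cs) (y y' : UT K) :
    blockNorm cubn cubn (extend (compress A S)⁻¹) y y' ≤ cs / m := by
  refine blockNorm_le_of_rowMass_le cubn cubn _ y y' (div_nonneg hcs hm.le) fun i _ => ?_
  calc rowMass cubn (extend (compress A S)⁻¹) i y'
      ≤ ∑ j ∈ Finset.univ.filter (fun j => cubn j = y'), m⁻¹ * Real.exp (-(κ * d i j)) :=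
        Finset.sum_le_sum fun j _ => norm_locInv_apply_le A S d hd0 hκ hm hc i j
    _ ≤ ∑ j, m⁻¹ * Real.exp (-(κ * d i j)) :=
        Finset.sum_le_sum_of_subset_of_nonneg (Finset.filter_subset _ _) fun j _ _ => by positivity
    _ = m⁻¹ * ∑ j, Real.exp (-(κ * d i j)) := by rw [Finset.mul_sum]
    _ ≤ m⁻¹ * cs := mul_le_mul_of_nonneg_left (hsite i) (inv_nonneg.2 hm.le)
    _ = cs / m := by rw [div_eq_inv_mul]

variable {E : Type*} [NormedAddCommGroup E] [NormedSpace ℂ E]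

/-- **Holomorphy of the local inverse in the configuration**: entries of `u ↦ extend((compress A(u) S)⁻¹)` are holomorphic
on the ball when `A` is entrywise holomorphic and conjugated-coercive there (Cramer, `differentiableOn_matrix_inv`).
[cite: Balaban1988RG2Cluster, p.15] -/
theorem differentiableOn_locInv {A : E → Matrix n n ℂ} {R : ℝ} (S : Finset n) (d : n → n → ℝ) {κ m : ℝ} (hm : 0 < m)
    (ha : ∀ i j, DifferentiableOn ℂ (fun u => A u i j) (ball (0 : E) R))
    (hc : ∀ u ∈ ball (0 : E) R, ∀ j, ∀ z : n → ℂ, m * nsq z ≤ (conjForm (A u) κ (fun e => d e j) z).re) (i j : n) :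
    DifferentiableOn ℂ (fun u => extend (compress (A u) S)⁻¹ i j) (ball (0 : E) R) := by
  by_cases hi : i ∈ S
  · by_cases hj : j ∈ S
    · simp_rw [extend_apply_of_mem _ hi hj]
      refine differentiableOn_matrix_inv (A := fun u => compress (A u) S) (fun k l => ha k l) (fun u hu => ?_) ⟨i, hi⟩ ⟨j, hj⟩
      exact ((Matrix.isUnit_iff_isUnit_det _).mp (isUnit_compress (A u) S d hm (hc u hu))).ne_zero
    · simp_rw [extend_apply_of_not_mem_right _ i hj]; exact differentiableOn_const _
  · simp_rw [extend_apply_of_not_mem_left _ hi j]; exact differentiableOn_const _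

/-- The inverse of the complexification of a real matrix is the complexification of its inverse. [folklore] -/
private theorem inv_map_ofReal {m' : Type} [Fintype m'] [DecidableEq m'] (M : Matrix m' m' ℝ) :
    (M.map (algebraMap ℝ ℂ))⁻¹ = M⁻¹.map (algebraMap ℝ ℂ) := by
  by_cases h : IsUnit M.det
  · apply Matrix.inv_eq_right_inv
    rw [← Matrix.map_mul, Matrix.mul_nonsing_inv _ h, Matrix.map_one _ (map_zero _) (map_one _)]
  · have h' : ¬IsUnit (M.map (algebraMap ℝ ℂ)).det := by
      rw [← RingHom.mapMatrix_apply, ← RingHom.map_det, isUnit_iff_ne_zero, map_ne_zero, ← isUnit_iff_ne_zero]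
      exact h
    rw [Matrix.nonsing_inv_apply_not_isUnit _ h', Matrix.nonsing_inv_apply_not_isUnit _ h, Matrix.map_zero _ (map_zero _)]

omit [Fintype n] in
/-- **Reality**: a real matrix has a real local inverse (print p. 15: real configurations, real operators). [folklore] -/
theorem im_locInv_zero (A : Matrix n n ℂ) (hA : ∀ i j, (A i j).im = 0) (S : Finset n) (i j : n) :
    (extend (compress A S)⁻¹ i j).im = 0 := by
  by_cases hi : i ∈ S
  · by_cases hj : j ∈ S
    · rw [extend_apply_of_mem _ hi hj]
      have e : compress A S = ((compress A S).map Complex.re).map (algebraMap ℝ ℂ) := by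
        ext k l; apply Complex.ext <;> simp [compress, hA k l]
      rw [e, inv_map_ofReal, Matrix.map_apply]
      exact Complex.ofReal_im _
    · rw [extend_apply_of_not_mem_right _ i hj, Complex.zero_im]
  · rw [extend_apply_of_not_mem_left _ hi j, Complex.zero_im]

end LocInv

/-! ## §4. END: Theorem 3.10 at one scale, block currency, with the local inverses CONSTRUCTED — letters on `Δ′(u)` only -/

section End

variable {d N' : ℕ} {ν : ℕ} {K : Fin ν → ℕ} [∀ i, NeZero (K i)]
variable {n : Type} [Fintype n] [DecidableEq n]
variable {E : Type*} [NormedAddCommGroup E] [NormedSpace ℂ E]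
variable {L₀ : DomainTerms d N' ν K n n E} {h : L₀.B → n → ℝ} {Es : L₀.B → Finset n} {K' : E → Matrix n n ℂ}
variable {ds : n → n → ℝ}
variable {c : B13.Consts} {cubn : n → UT K} {X : Finset (UT K)} {R CK M m κc cs r₁ r : ℝ} {mJ nD nC : ℕ}
variable {ρ₀ ε₀ κ₀ μ cμ : ℝ}

/-- **THEOREM 3.10 AT ONE SCALE FROM LETTERS ON `Δ′(u) = 1 + K′(u)` ALONE**: a domain skeleton `L₀` (geometry `r, m_J, n_D`,
`#dom ≤ n_C`), partition `{h_□}` (`|h| ≤ 1`, `1∕M`-Lipschitz in the site pseudo-distance `ds`, supports `Es □` with their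
`r₁`-neighbourhood cubes inside `dom □`), `K′` entrywise holomorphic on the `R`-ball with range `r₁` and block bound `C_K`,
`1 + K′(u)` CONJUGATED-COERCIVE `m > 0` at rate `κ_c ≥ 0` along every column weight `ds(·,j)` UNIFORMLY on the ball
(`ds` symmetric, `ds(j,j) = 0`), site row sum `Σ_j e^{−κ_c ds(i,j)} ≤ c_s`, cube row sum `(μ, c_μ)`, rates, and the margin
with `C_L = c_s∕m`, `λ_K = (r₁∕M)C_K` ⟹ with the LOCAL INVERSES `G′_□(u) := extend((compress (1 + K′(u)) (Es □))⁻¹)` the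
σ-decorated glued family is a `BlockWalkExpansion`, every letter torus-free; "M sufficiently large" literal.
[cite: Balaban1985BackgroundPropagators, Thms 3.1–3.3 (3.42) p.399, Cor 3.6 p.408, Thm 3.7 (3.87)–(3.90) p.409, Cor 3.8 p.410, Thm 3.10 p.416; Balaban1988RG2Cluster, (1.11) p.5, p.13, p.15] -/
theorem blockWalkExpansion_accretive
    (hanchor : ∀ b, L₀.anchor b ∈ L₀.dom b) (hdiam : ∀ b, ∀ z ∈ L₀.dom b, ∀ z' ∈ L₀.dom b, tdist1 K z z' ≤ r)
    (hJ : ∀ b, (L₀.J b).card ≤ mJ) (hX : ∀ b, (L₀.J b).Nonempty → (L₀.dom b ∩ X).Nonempty)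
    (hmult : ∀ z : UT K, (Finset.univ.filter fun b => L₀.anchor b = z).card ≤ nD)
    (hsupp : ∀ b y, y ∉ Es b → h b y = 0) (habs : ∀ b y, |h b y| ≤ 1) (hE : ∀ b y, y ∈ Es b → cubn y ∈ L₀.dom b)
    (hKan : ∀ i j, DifferentiableOn ℂ (fun u => K' u i j) (ball (0 : E) R))
    (hKbd : ∀ u ∈ ball (0 : E) R, ∀ y y', blockNorm cubn cubn (K' u) y y' ≤ CK) (hCK : 0 ≤ CK)
    (hM : 0 < M) (hr₁ : 0 ≤ r₁) (hsymm : ∀ i j, ds i j = ds j i) (hd0 : ∀ j, ds j j = 0)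
    (hLip : ∀ b i j, |h b i - h b j| ≤ ds i j / M) (hKrange : ∀ u i j, K' u i j ≠ 0 → ds i j ≤ r₁)
    (hdomE : ∀ b i, (∃ k ∈ Es b, ds i k ≤ r₁) → cubn i ∈ L₀.dom b)
    (hcard : ∀ b, (L₀.dom b).card ≤ nC)
    (hm : 0 < m) (hκc : 0 ≤ κc)
    (hcoer : ∀ u ∈ ball (0 : E) R, ∀ j, ∀ z : n → ℂ, m * nsq z ≤ (conjForm (1 + K' u) κc (fun e => ds e j) z).re)
    (hcs : 0 ≤ cs) (hsite : ∀ i, ∑ j, Real.exp (-(κc * ds i j)) ≤ cs)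
    (hκ₁ : 0 ≤ c.κ₁) (hμ : 0 ≤ μ) (hμε : 3 * μ ≤ ε₀) (hμκ : 2 * μ ≤ κ₀) (hwin : κ₀ + μ ≤ ρ₀ - ε₀) (hcμ : 0 ≤ cμ)
    (hrow : RowSum (toB6 (torusGeom K 0 0 0) 0 True) μ cμ)
    (hq : cμ * (cμ * 1 *
      (1 * (((nC * (r₁ / M * CK) * (cs / m)) * Real.exp (c.κ₁ * mJ) * Real.exp (2 * ρ₀ * r)) * Real.exp (μ * r) *
        (nD * cμ))) * cμ) * cμ < 1) :
    ∃ (W : Type) (T : W → (TPt d N' → ℂ) → E → Matrix n n ℂ) (SX : Set W) (A : W → ℝ) (D : W → UT K → UT K → ℝ)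
      (ρ' : ℝ), BlockWalkExpansion c cubn cubn
        (fun σ₀ u =>
          (withOp L₀ fun b u => Hd h b * extend (compress (1 + K' u) (Es b))⁻¹ * Hd h b).kernel σ₀ u *
          ((1 : Matrix n n ℂ) + (-1 : ℂ) •
            (withOp L₀ fun b u =>
              (Hd h b * K' u - K' u * Hd h b) * extend (compress (1 + K' u) (Es b))⁻¹ * Hd h b).kernel σ₀ u)⁻¹)
        X R (ε₀ - 3 * μ) (κ₀ - 2 * μ)
        (cμ * (((cs / m) * Real.exp (c.κ₁ * mJ) * Real.exp (2 * ρ₀ * r)) * Real.exp (μ * r) * (nD * cμ)) *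
          (1 * (1 - cμ * (cμ * 1 *
            (1 * (((nC * (r₁ / M * CK) * (cs / m)) * Real.exp (c.κ₁ * mJ) * Real.exp (2 * ρ₀ * r)) * Real.exp (μ * r) *
              (nD * cμ))) * cμ) * cμ)⁻¹) * cμ)
        T SX A D ρ' ∧
      ∀ ω, DomBy (toB6 (torusGeom K 0 0 0) 0 True) (D ω) := by
  exact blockWalkExpansion_parametrix_lipschitz (L := withOp L₀ fun b u => extend (compress (1 + K' u) (Es b))⁻¹)
    hanchor hdiam hJ hX hmult hsupp habs hE
    (fun b i j => differentiableOn_locInv (Es b) ds hm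
      (fun k l => by
        simp only [Matrix.add_apply]
        exact (differentiableOn_const _).add (hKan k l)) hcoer i j)
    (fun b u hu y y' => blockNorm_locInv_le cubn (1 + K' u) (Es b) ds hd0 hκc hm (hcoer u hu) hcs hsite y y')
    (div_nonneg hcs hm.le) hKan hKbd hCK hM hr₁ hsymm (fun i => by rw [hd0]; exact hr₁) hLip hKrange hdomE hcard
    hκ₁ hμ hμε hμκ hwin hcμ hrow hq

/-- **… and the two ALGEBRAIC letters of (3.88) hold for these local inverses** (`P_□G′_□ = G′_□`, `P_□Δ′P_□G′_□ = P_□`), so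
`D4WalkBlockParametrix.resummation_388` ∕ `glued_one_eq_inv` apply: at `σ ≡ 1` the glued family IS `(1 + K′(u))⁻¹`.
[cite: Balaban1985BackgroundPropagators, (3.88) p.409] -/
theorem locInv_letters (u : E) (hu : u ∈ ball (0 : E) R) (hm : 0 < m)
    (hcoer : ∀ u ∈ ball (0 : E) R, ∀ j, ∀ z : n → ℂ, m * nsq z ≤ (conjForm (1 + K' u) κc (fun e => ds e j) z).re)
    (b : L₀.B) :
    Pj Es b * extend (compress (1 + K' u) (Es b))⁻¹ = extend (compress (1 + K' u) (Es b))⁻¹ ∧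
      Pj Es b * (1 + K' u) * Pj Es b * extend (compress (1 + K' u) (Es b))⁻¹ = Pj Es b :=
  ⟨Pj_mul_extend Es b _, Pj_mul_mul_Pj_mul_extend_inv Es b (1 + K' u) (isUnit_compress _ _ ds hm (hcoer u hu))⟩

end End

end Summit.QuantumFields.BalabanUV.Gaps.D4WalkBlockLocalInverse

end
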